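import Summits.AtomisticToContinuum.Crystallization.Theorems.OverbindingBudgetElasticSplitDilation
import Summits.AtomisticToContinuum.Crystallization.Theorems.ChargedEnergyGap.Negative.Unconditional

/-!
# OverbindingBudget — «ElasticSplit»: the dense-charge branch from the shared crux `ChargedEnergyGap` (decomp-a2c lens-4, generation 27; proofs)

Helper file (`--supports stmt-AtomisticToContinuum-31280`; statements in `…OverbindingBudgetElasticSplitStatements`).

* `chargeDensityRelax_of_chargedEnergyGap : ChargedEnergyGap → ChargeDensityRelax T₀ D` (all `T₀, D`) — CROSS-ROUTE CONCORDANCE: the hinge crux of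
  route PricedLinkCensus (`Theses.PricedLinkCensus.ChargedEnergyGap`, stmt-AtomisticToContinuum-14231: `E_LJ(y) ≥ N e⋆ + κ #{charged at 1/100}
  − C N^{2/3}`) prices dense charge in cube chunks by a volume-order amount, and the finite ground states cost at most `(e⋆ + ε) N`
  eventually (`ChargedEnergyGapNegative.crysEnergyLimit`, in tree, unconditional); packing (`…CubeTails.card_le_of_separated_of_box`) converts
  `#F` into `ℓ³`.  Only `UniformlyDiscrete Y` of the clean class is used.
* `rdef_of_grossU_elasticSplit_record : GrossCleanBallsU (1/250) 10 → ChargedEnergyGap → LocalRelaxationTest (1/250) 10 →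
  ElasticLiouvilleLaw (1/250) 10 → CleanlessExcessT → CoherentResidual 10 → RobustDefectLimitWindows` — the cone of generation 27.
-/

namespace Summit.AtomisticToContinuum.Crystallization.Theorems.OverbindingBudgetElasticSplitPricing

open Filter Metric Set Topology
open scoped BigOperators
open Literature.MathematicalPhysics.StatisticalMechanics
open Summit.AtomisticToContinuum.Crystallization.Theses.OverbindingBudget (RobustDefectLimitWindows)
open Summit.AtomisticToContinuum.Crystallization.Theses.PricedLinkCensus (ChargedEnergyGap)
open Summit.AtomisticToContinuum.Crystallization.Theorems.ChargedEnergyGapNegative (crysEnergyLimit)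
open Summit.AtomisticToContinuum.Crystallization.Theorems.OverbindingBudgetCubeTails (card_le_of_separated_of_box)
open Summit.AtomisticToContinuum.Crystallization.Theorems.OverbindingBudgetGradedBareness (CleanlessExcessT)
open Summit.AtomisticToContinuum.Crystallization.Theorems.OverbindingBudgetCoherentCut (CoherentResidual)
open Summit.AtomisticToContinuum.Crystallization.Theorems.OverbindingBudgetUniformCutStatements (GrossCleanBallsU)
open Summit.AtomisticToContinuum.Crystallization.Theorems.OverbindingBudgetEdgeRelaxationStatements
  (StrainedCubes CleanClass EdgeRelaxationLaw)
open Summit.AtomisticToContinuum.Crystallization.Theorems.OverbindingBudgetElasticSplitStatements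
open Summit.AtomisticToContinuum.Crystallization.Theorems.OverbindingBudgetElasticSplitDilation
  (edgeRelaxationLaw_of_split rdef_of_grossU_split_coherent)

/-! ## Tools -/

/-- `x^{2/3} ≤ x / M` once `M³ ≤ x` (`M > 0`). [this file] -/
theorem rpow_two_thirds_le {x M : ℝ} (hM : 0 < M) (h : M ^ 3 ≤ x) : x ^ (2 / 3 : ℝ) ≤ x / M := by
  have hx : 0 < x := lt_of_lt_of_le (pow_pos hM 3) h
  have h13 : M ≤ x ^ (1 / 3 : ℝ) := by
    have hM3 : (M ^ 3) ^ (1 / 3 : ℝ) = M := by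
      rw [← Real.rpow_natCast, ← Real.rpow_mul hM.le]
      norm_num
    rw [← hM3]
    exact Real.rpow_le_rpow (pow_nonneg hM.le 3) h (by norm_num)
  have hsplit : x ^ (2 / 3 : ℝ) = x / x ^ (1 / 3 : ℝ) := by
    rw [show (2 / 3 : ℝ) = 1 + -(1 / 3) by norm_num, Real.rpow_add hx, Real.rpow_one, Real.rpow_neg hx.le]
    exact (div_eq_mul_inv _ _).symm
  rw [hsplit]
  exact div_le_div_of_nonneg_left hx.le hM h13

/-- Twice the interaction energy of an injective family is the double sum over its image Finset (`V_LJ(0) = 0` on the diagonal). [this file] -/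
theorem two_mul_interactionEnergy_eq_sum_sum_image {N : ℕ} {y : Fin N → EuclideanSpace ℝ (Fin 3)} (hy : Function.Injective y) :
    2 * interactionEnergy lennardJones y =
      ∑ x ∈ Finset.univ.image y, ∑ z ∈ Finset.univ.image y, lennardJones (dist x z) := by
  rw [two_mul_interactionEnergy_eq_sum_sum lennardJones lennardJones_zero, Finset.sum_image fun _ _ _ _ h => hy h]
  exact Finset.sum_congr rfl fun i _ =>
    (Finset.sum_image (f := fun z => lennardJones (dist (y i) z)) fun _ _ _ _ h => hy h).symm

/-- Eventually the finite ground states cost at most `(e⋆ + ε) N`:  from `E(N)/N → e⋆` (`crysEnergyLimit`). [this file] -/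
theorem groundStateEnergy_le_eventually {ε : ℝ} (hε : 0 < ε) :
    ∃ N₁ : ℕ, 1 ≤ N₁ ∧ ∀ N : ℕ, N₁ ≤ N →
      groundStateEnergy lennardJones 3 N ≤ ((⨅ Q : PeriodicConfiguration 3, Q.energyPerParticle lennardJones) + ε) * N := by
  have h := (Metric.tendsto_atTop.1 crysEnergyLimit) ε hε
  obtain ⟨N₀, hN₀⟩ := h
  refine ⟨max N₀ 1, le_max_right _ _, fun N hN => ?_⟩
  have hN0 : N₀ ≤ N := (le_max_left _ _).trans hN
  have hNpos : (0 : ℝ) < N := by exact_mod_cast (le_max_right N₀ 1).trans hN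
  have hd := hN₀ N hN0
  rw [Real.dist_eq, abs_lt] at hd
  have h2 : groundStateEnergy lennardJones 3 N / N < (⨅ Q : PeriodicConfiguration 3, Q.energyPerParticle lennardJones) + ε := by
    linarith [hd.2]
  rw [div_lt_iff₀ hNpos] at h2
  exact h2.le

/-! ## The dense-charge branch from `ChargedEnergyGap` -/

/-- **Cross-route concordance**: `ChargedEnergyGap` (stmt-AtomisticToContinuum-14231, route PricedLinkCensus) implies the dense-charge branch
`ChargeDensityRelax T₀ D` of RELAX, for all `T₀, D` (only uniform discreteness of the clean class is used). [this file] -/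
theorem chargeDensityRelax_of_chargedEnergyGap {T₀ D : ℝ} (hCEG : ChargedEnergyGap) : ChargeDensityRelax T₀ D := by
  intro Y hY t ht L hV ρ hρ hd
  obtain ⟨⟨δ, hδ, hsep⟩, -, -, -, -, -⟩ := hY
  obtain ⟨κ, C, hκ, hgap⟩ := hCEG
  set e : ℝ := ⨅ Q : PeriodicConfiguration 3, Q.energyPerParticle lennardJones with he
  -- constants
  set B : ℝ := 27 / δ ^ 3 with hB
  have hBpos : 0 < B := by positivity
  set Cp : ℝ := max C 0 with hCp
  have hCp0 : 0 ≤ Cp := le_max_right _ _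
  have hCle : C ≤ Cp := le_max_left _ _
  set ε : ℝ := κ * ρ / (4 * B) with hε
  have hεpos : 0 < ε := by positivity
  obtain ⟨N₁, hN₁1, hN₁⟩ := groundStateEnergy_le_eventually hεpos
  set M : ℝ := 4 * Cp * B / (κ * ρ) + 1 with hM
  have hMpos : 0 < M := by positivity
  have hM1 : 4 * Cp * B / (κ * ρ) ≤ M := by linarith
  -- the rate
  refine ⟨κ * ρ / 2, by positivity, ?_⟩
  intro ℓ₀
  set ℓ₁ : ℝ := max (max ℓ₀ (max 1 δ)) (max ((N₁ : ℝ) / ρ) (M ^ 3 / ρ)) with hℓ₁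
  obtain ⟨ℓ, hℓ, c, N, y, hy, hr, hcc⟩ := hd ℓ₁
  have hℓ₀ : ℓ₀ ≤ ℓ := le_trans (le_trans (le_max_left _ _) (le_max_left _ _)) hℓ
  have hℓ1 : 1 ≤ ℓ := le_trans (le_trans (le_trans (le_max_left _ _) (le_max_right _ _)) (le_max_left _ _)) hℓ
  have hℓδ : δ ≤ ℓ := le_trans (le_trans (le_trans (le_max_right _ _) (le_max_right _ _)) (le_max_left _ _)) hℓ
  have hℓN : (N₁ : ℝ) / ρ ≤ ℓ := le_trans (le_trans (le_max_left _ _) (le_max_right _ _)) hℓ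
  have hℓM : M ^ 3 / ρ ≤ ℓ := le_trans (le_trans (le_max_right _ _) (le_max_right _ _)) hℓ
  have hℓpos : 0 < ℓ := by linarith
  have hℓ3 : ℓ ≤ ℓ ^ 3 := by
    have h1 : (1 : ℝ) ≤ ℓ ^ 2 := one_le_pow₀ hℓ1
    calc ℓ = ℓ * 1 := (mul_one ℓ).symm
      _ ≤ ℓ * ℓ ^ 2 := mul_le_mul_of_nonneg_left h1 hℓpos.le
      _ = ℓ ^ 3 := by ring
  -- the chunk
  classical
  set F : Finset (EuclideanSpace ℝ (Fin 3)) := Finset.univ.image y with hF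
  have hFcoe : (↑F : Set (EuclideanSpace ℝ (Fin 3))) = Y ∩ {z | ∀ i : Fin 3, c i ≤ z i ∧ z i < c i + ℓ} := by
    rw [hF, Finset.coe_image, Finset.coe_univ, Set.image_univ, hr]
  have hFcard : F.card = N := by
    rw [hF, Finset.card_image_of_injective _ hy, Finset.card_univ, Fintype.card_fin]
  have hmem : ∀ z ∈ F, z ∈ Y ∧ ∀ i : Fin 3, c i ≤ z i ∧ z i < c i + ℓ := by
    intro z hz
    have hz' : z ∈ (↑F : Set (EuclideanSpace ℝ (Fin 3))) := hz
    rw [hFcoe] at hz'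
    exact hz'
  -- energy of the chunk = interaction energy of `y`
  have hU : 1 / 2 * ∑ x ∈ F, ∑ z ∈ F, lennardJones (dist x z) = interactionEnergy lennardJones y := by
    have h2 := two_mul_interactionEnergy_eq_sum_sum_image hy
    rw [← hF] at h2
    linarith
  -- counts: `ρ ℓ³ ≤ cc ≤ N ≤ B ℓ³`
  have hccN : (chargedCount y : ℝ) ≤ N := by
    have h1 : chargedCount y ≤ Nat.card (Fin N) := Finite.card_subtype_le _
    rw [Nat.card_eq_fintype_card, Fintype.card_fin] at h1
    exact_mod_cast h1
  have hNlow : ρ * ℓ ^ 3 ≤ N := hcc.trans hccN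
  have hNB : (N : ℝ) ≤ B * ℓ ^ 3 := by
    have hbox := card_le_of_separated_of_box F (fun i => c i) (fun _ => ℓ) hδ (fun _ => hℓpos.le)
      (fun z hz i => (hmem z hz).2 i) (fun z hz w hw hzw => hsep z (hmem z hz).1 w (hmem w hw).1 hzw)
    rw [Finset.prod_const, Finset.card_univ, Fintype.card_fin, hFcard] at hbox
    have h3 : 2 * ℓ / δ + 1 ≤ 3 * ℓ / δ := by
      rw [div_add_one (ne_of_gt hδ), div_le_div_iff_of_pos_right hδ]
      linarith
    have h4 : (2 * ℓ / δ + 1) ^ 3 ≤ (3 * ℓ / δ) ^ 3 := by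
      apply pow_le_pow_left₀ (by positivity) h3
    calc (N : ℝ) ≤ (2 * ℓ / δ + 1) ^ 3 := hbox
      _ ≤ (3 * ℓ / δ) ^ 3 := h4
      _ = B * ℓ ^ 3 := by rw [hB]; field_simp; ring
  have hN₁N : N₁ ≤ N := by
    have h1 : (N₁ : ℝ) ≤ ρ * ℓ := by
      rw [div_le_iff₀ hρ] at hℓN
      linarith
    have h2 : ρ * ℓ ≤ ρ * ℓ ^ 3 := mul_le_mul_of_nonneg_left hℓ3 hρ.le
    exact_mod_cast (h1.trans (h2.trans hNlow))
  have hNM : M ^ 3 ≤ (N : ℝ) := by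
    have h1 : M ^ 3 ≤ ρ * ℓ := by
      rw [div_le_iff₀ hρ] at hℓM
      linarith
    have h2 : ρ * ℓ ≤ ρ * ℓ ^ 3 := mul_le_mul_of_nonneg_left hℓ3 hρ.le
    exact h1.trans (h2.trans hNlow)
  -- the two energy bounds
  have hE : groundStateEnergy lennardJones 3 N ≤ (e + ε) * N := hN₁ N hN₁N
  have hG : (N : ℝ) * e + κ * (chargedCount y : ℝ) - C * (N : ℝ) ^ (2 / 3 : ℝ) ≤ interactionEnergy lennardJones y :=
    hgap N y hy
  -- error terms
  have hN0 : (0 : ℝ) ≤ N := Nat.cast_nonneg N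
  have hrpow : (N : ℝ) ^ (2 / 3 : ℝ) ≤ N / M := rpow_two_thirds_le hMpos hNM
  have hrpow0 : 0 ≤ (N : ℝ) ^ (2 / 3 : ℝ) := Real.rpow_nonneg hN0 _
  have herr1 : C * (N : ℝ) ^ (2 / 3 : ℝ) ≤ κ * ρ / 4 * ℓ ^ 3 := by
    have h1 : C * (N : ℝ) ^ (2 / 3 : ℝ) ≤ Cp * (N : ℝ) ^ (2 / 3 : ℝ) := mul_le_mul_of_nonneg_right hCle hrpow0
    have h2 : Cp * (N : ℝ) ^ (2 / 3 : ℝ) ≤ Cp * (N / M) := mul_le_mul_of_nonneg_left hrpow hCp0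
    have h3 : Cp * (N / M) ≤ Cp * (B * ℓ ^ 3 / M) :=
      mul_le_mul_of_nonneg_left (div_le_div_of_nonneg_right hNB hMpos.le) hCp0
    have h4 : Cp * (B * ℓ ^ 3 / M) ≤ κ * ρ / 4 * ℓ ^ 3 := by
      -- `Cp B / M ≤ κ ρ / 4` since `M ≥ 4 Cp B / (κ ρ)`
      have hkr : 0 < κ * ρ := by positivity
      have h5 : Cp * B ≤ κ * ρ / 4 * M := by
        have := mul_le_mul_of_nonneg_left hM1 (le_of_lt hkr)
        rw [mul_div_cancel₀ _ (ne_of_gt hkr)] at this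
        linarith
      have hl3 : 0 ≤ ℓ ^ 3 := by positivity
      rw [show Cp * (B * ℓ ^ 3 / M) = Cp * B / M * ℓ ^ 3 by field_simp]
      apply mul_le_mul_of_nonneg_right _ hl3
      rw [div_le_iff₀ hMpos]
      linarith
    linarith
  have herr2 : ε * N ≤ κ * ρ / 4 * ℓ ^ 3 := by
    have h1 : ε * N ≤ ε * (B * ℓ ^ 3) := mul_le_mul_of_nonneg_left hNB hεpos.le
    have h2 : ε * (B * ℓ ^ 3) = κ * ρ / 4 * ℓ ^ 3 := by
      rw [hε]
      field_simp
    linarith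
  have hmain : κ * (ρ * ℓ ^ 3) ≤ κ * (chargedCount y : ℝ) := mul_le_mul_of_nonneg_left hcc hκ.le
  refine ⟨ℓ, hℓ₀, c, F, hFcoe, ?_⟩
  rw [hFcard, hU]
  have hEe : groundStateEnergy lennardJones 3 N ≤ N * e + ε * N := by linarith
  linarith

/-- **RELAX from the shared crux and the two tests**: `ChargedEnergyGap → LocalRelaxationTest → ElasticLiouvilleLaw → EdgeRelaxationLaw`. [this file] -/
theorem edgeRelaxationLaw_of_chargedEnergyGap_local_liouville {T₀ D : ℝ} (hCEG : ChargedEnergyGap) (hL : LocalRelaxationTest T₀ D)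
    (hE : ElasticLiouvilleLaw T₀ D) : EdgeRelaxationLaw T₀ D :=
  edgeRelaxationLaw_of_split (chargeDensityRelax_of_chargedEnergyGap hCEG) hL hE

/-- The cone of generation 27: `GrossCleanBallsU T₀ 10 → ChargedEnergyGap → LocalRelaxationTest T₀ 10 → ElasticLiouvilleLaw T₀ 10 →
CleanlessExcessT → CoherentResidual 10 → RobustDefectLimitWindows` (`0 < T₀`). [this file] -/
theorem rdef_of_grossU_elasticSplit_coherent {T₀ : ℝ} (hT : 0 < T₀) (hG : GrossCleanBallsU T₀ 10) (hCEG : ChargedEnergyGap)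
    (hL : LocalRelaxationTest T₀ 10) (hE : ElasticLiouvilleLaw T₀ 10) (hCE : CleanlessExcessT) (hR : CoherentResidual 10) :
    RobustDefectLimitWindows :=
  rdef_of_grossU_split_coherent hT hG (chargeDensityRelax_of_chargedEnergyGap hCEG) hL hE hCE hR

/-- The cone at the record numerals `T₀ = 1/250`. [this file] -/
theorem rdef_of_grossU_elasticSplit_record (hG : GrossCleanBallsU (1 / 250) 10) (hCEG : ChargedEnergyGap)
    (hL : LocalRelaxationTest (1 / 250) 10) (hE : ElasticLiouvilleLaw (1 / 250) 10) (hCE : CleanlessExcessT)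
    (hR : CoherentResidual 10) : RobustDefectLimitWindows :=
  rdef_of_grossU_elasticSplit_coherent (T₀ := 1 / 250) (by norm_num) hG hCEG hL hE hCE hR

end Summit.AtomisticToContinuum.Crystallization.Theorems.OverbindingBudgetElasticSplitPricing
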